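import Summits.BirchSwinnertonDyer.BirchSwinnertonDyer.Theorems.ResidualThetaTransportAtTwoResidualThetaMainConjectureAtTwoThetaSumThreeTerm
import Literature.NumberTheory.EllipticCurves.MazurTateElementCoeffField
import HarnessLib

/-!
# Crux `ResidualThetaMainConjectureAtTwo` (stmt-BirchSwinnertonDyer-20787), line `birth` v5 — toward stub (R1c)
# `stub_pollackPairKAtTwo`: the THREE-TERM RELATION of the Mazur–Tate elements `θ_n(g; Ω) ∈ K_g[T]` of a newform
# with Hecke field `K_g` at a prime with `a_p(g) = 0` — part 2 (instantiation of the abstract file `…ThetaSumThreeTerm`)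

Cell `bsd-wall`, seat `bsd-wall-rtt-p2` (LEAD PROVER, line mode, g2). THEOREMS ONLY (no `def`, no named fact, no
`sorry`); `--supports stmt-BirchSwinnertonDyer-20787`; closes nothing by itself.

WHY. Stub (R1c) asks for a Pollack pair of the CM partner `g` over `𝓞 = 𝓞_{ℚ₂(ι K_g)}` at `p = 2`
(`IsPollackPairK g ι Ω L⁺ L⁻`). Pollack's construction (tree: `pollack_exists_plusMinusPAdicLFunction_holds`, RATIONAL
newforms, `p` odd; `Sprung2017.exists_isSprungPair_two`, rational, `p = 2`) starts from the three-term (distribution)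
relation of the Mazur–Tate elements, `π_{n+2/n+1} θ_{n+2} = a_p θ_{n+1} − ν θ_n`, i.e. for `a_p = 0`:
`ω_{n+1} ∣ θ_{n+2} + Φ_{p^{n+1}}(1+T)·θ_n`. The tree proves it for `mazurTateElement f p n ∈ ℚ[T]` of a RATIONAL
newform (`cyclotomicOmega_dvd_mazurTateElement_add`). This file proves it for the `K_g`-valued elements
`mazurTateElementK g Ω p n` of ANY newform `g ∈ S₂(Γ₀(M))` with `p ∤ M`, `a_p(g) = 0` and ANY plus period `Ω`
(`IsPlusPeriod g Ω`), by first isolating the ABSTRACT statement: for every function `φ : ℚ → F` into a commutative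
ring which is `ℤ`-PERIODIC and HECKE-NULL at `p` (`∑_{j<p} φ((r+j)/p) = −φ(pr)`), the theta sums
`Θ_m(φ) = ∑_η ∑_{s mod p^m} φ([η γ^s/p^{m+e₀}])(1+T)^s ∈ F[T]` satisfy `ω_{n+1} ∣ Θ_{n+2} + Φ_{p^{n+1}}(1+T) Θ_n`
(`cyclotomicOmega_dvd_thetaSum_add`; the proof is the tree's, fibre by fibre, with the symbol function abstracted),
and then instantiating `φ = plusSymbolK g Ω` (`[r]⁺_{g,Ω} = plusSymbol g r / Ω ∈ K_g`): Hecke-null by the tree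
theorem `cuspCoeff_mul_plusSymbol` (`a_p(g)·[r]⁺ = ∑_j [(r+j)/p]⁺ + [pr]⁺`, any newform, `p ∤ M`) with `a_p(g) = 0`,
periodic by `modularSymbol_add_intCast_holds` — `cyclotomicOmega_dvd_mazurTateElementK_add`. BSD is not proved by any
of this; (R1c) further needs the `𝓞`-adic limit and Rohrlich's non-vanishing (both in the tree for the rational
case / for newforms), see `Lines/birth.md`.

References: B. Mazur, J. Tate, J. Teitelbaum, Invent. Math. 84 (1986) §I.4 (4.2), §I.10 (10.2)
[MazurTateTeitelbaum1986Invent]; R. Pollack, Duke Math. J. 118 (2003) §6.5 [Pollack2003]; R. Pollack, T. Weston, Duke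
Math. J. 156 (2011) §2.1–2.2 [PollackWeston2011MT].
-/

set_option linter.dupNamespace false
set_option autoImplicit false

noncomputable section

open scoped Classical MatrixGroups ModularForm

open CongruenceSubgroup Polynomial Literature.NumberTheory.EllipticCurves
  Literature.NumberTheory.EllipticCurves.ModularForms

namespace Summit.BirchSwinnertonDyer.BirchSwinnertonDyer.Theorems.ResidualThetaLayer

/-! ## §4. Instantiation: the Mazur–Tate elements of a newform with Hecke field `K_g` -/

section Newform

variable {M : ℕ} [NeZero M] {g : CuspForm (Gamma0 M) 2} {p : ℕ} [Fact p.Prime] {Ω : ℂ}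

/-- **`[·]⁺_{g,Ω}` is `ℤ`-periodic**: `[r + k]⁺_{g,Ω} = [r]⁺_{g,Ω}` (the modular symbol `{∞, r}` only depends on
`r mod 1`, `modularSymbol_add_intCast_holds`). [cite: MazurTateTeitelbaum1986Invent, §I.4] -/
theorem plusSymbolK_add_intCast (hΩ : IsPlusPeriod g Ω) (r : ℚ) (k : ℤ) :
    plusSymbolK g Ω (r + k) = plusSymbolK g Ω r := by
  apply Subtype.ext
  rw [IsPlusPeriod.coe_plusSymbolK g hΩ, IsPlusPeriod.coe_plusSymbolK g hΩ]
  have h1 := modularSymbol_add_intCast_holds g r k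
  have h2 := modularSymbol_add_intCast_holds g (-r) (-k)
  rw [Int.cast_neg, ← neg_add] at h2
  rw [plusSymbol, plusSymbol, h1, h2]

/-- **`[·]⁺_{g,Ω}` is Hecke-null at `p` when `a_p(g) = 0`**: `∑_{j<p} [(r+j)/p]⁺_{g,Ω} = −[pr]⁺_{g,Ω}` for a
newform `g ∈ S₂(Γ₀(M))`, `p ∤ M`, `a_p(g) = 0` and a plus period `Ω` (the Hecke relation `cuspCoeff_mul_plusSymbol`
divided by `Ω`). [cite: MazurTateTeitelbaum1986Invent, §I.4 (4.2)] -/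
theorem sum_range_plusSymbolK_div_eq_neg (hg : IsNewform0 g) (hΩ : IsPlusPeriod g Ω) (hpM : ¬ p ∣ M)
    (hap : cuspCoeff g p = 0) (r : ℚ) :
    ∑ j ∈ Finset.range p, plusSymbolK g Ω ((r + j) / p) = -plusSymbolK g Ω (p * r) := by
  have hp : p.Prime := Fact.out
  have h := cuspCoeff_mul_plusSymbol p hg hp hpM r
  rw [hap, zero_mul] at h
  apply Subtype.ext
  push_cast
  simp_rw [IsPlusPeriod.coe_plusSymbolK g hΩ]
  rw [← Finset.sum_div, ← Fin.sum_univ_eq_sum_range (fun j ↦ plusSymbol g ((r + j) / p)) p,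
    eq_neg_of_add_eq_zero_left h.symm, neg_div]

/-- **The three-term relation of the Mazur–Tate elements of `g` over `K_g` at `a_p(g) = 0`**: for a newform
`g ∈ S₂(Γ₀(M))`, a prime `p ∤ M` with `a_p(g) = 0` and a plus period `Ω`, in `K_g[T]`:
`ω_{n+1} ∣ θ_{n+2}(g; Ω) + Φ_{p^{n+1}}(1+T) · θ_n(g; Ω)` (Mazur–Tate–Teitelbaum §I.10 (10.2) with `a_p = 0`; the
`K_g`-coefficient form of the tree's `cyclotomicOmega_dvd_mazurTateElement_add`).
[cite: MazurTateTeitelbaum1986Invent, §I.10 Prop. (10.2)] [cite: PollackWeston2011MT, §2.1 (2.1)] -/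
theorem cyclotomicOmega_dvd_mazurTateElementK_add (hg : IsNewform0 g) (hΩ : IsPlusPeriod g Ω) (hpM : ¬ p ∣ M)
    (hap : cuspCoeff g p = 0) (n : ℕ) :
    (cyclotomicOmega p (n + 1)).map (Int.castRingHom (coeffField g)) ∣
      mazurTateElementK g Ω p (n + 2) +
        ((cyclotomic (p ^ (n + 1)) ℤ).comp (X + 1)).map (Int.castRingHom (coeffField g)) *
          mazurTateElementK g Ω p n := by
  classical
  haveI := neZero_torsionOrder p
  haveI := Fintype.ofFinite (rootsOfUnity (torsionOrder p) ℤ_[p])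
  have h := cyclotomicOmega_dvd_thetaSum_add (plusSymbolK g Ω) (sum_range_plusSymbolK_div_eq_neg hg hΩ hpM hap)
    (plusSymbolK_add_intCast hΩ) n
  simp only [mazurTateElementK, finsum_eq_sum_of_fintype]
  exact h

/-! ## §5. `ω^∓`-divisibility of `θ_n(g; Ω)` and compatibility of the quotients (Pollack Prop. 6.18, proof) -/

/-- **`ω⁻_{2m} ∣ θ_{2m}` in `K_g[T]`** (`a_p = 0`): by induction on `m` from the three-term relation
`θ_{2m+2} = ω_{2m+1} C − Φ_{p^{2m+1}}(1+T) θ_{2m}`, since `ω⁻_{2m+2} = ω⁻_{2m} Φ_{p^{2m+1}}(1+T)`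
divides both `ω_{2m+1} = T ω⁺_{2m+1} ω⁻_{2m+1}` (`ω⁻_{2m+1} = ω⁻_{2m+2}`) and `Φ_{p^{2m+1}}(1+T) θ_{2m}`.
Equivalently: `θ_{2m}` vanishes at `ζ - 1` for every `ζ` of order `p^k`, `k` odd, `k < 2m`
(Pollack 2003, proof of Prop. 6.18). [cite: Pollack2003, Prop. 6.18 (proof)] -/
theorem cyclotomicOmegaMinus_dvd_mazurTateElementK (hg : IsNewform0 g) (hΩ : IsPlusPeriod g Ω) (hpM : ¬ p ∣ M)
    (hap : cuspCoeff g p = 0) (m : ℕ) :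
    (cyclotomicOmegaMinus p (2 * m)).map (Int.castRingHom (coeffField g)) ∣ mazurTateElementK g Ω p (2 * m) := by
  induction m with
  | zero => simp
  | succ m ih =>
    obtain ⟨C, hC⟩ := cyclotomicOmega_dvd_mazurTateElementK_add hg hΩ hpM hap (2 * m)
    have h : mazurTateElementK g Ω p (2 * (m + 1)) =
        (cyclotomicOmega p (2 * m + 1)).map (Int.castRingHom (coeffField g)) * C -
          ((cyclotomic (p ^ (2 * m + 1)) ℤ).comp (X + 1)).map (Int.castRingHom (coeffField g)) *
            mazurTateElementK g Ω p (2 * m) := by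
      rw [show 2 * (m + 1) = 2 * m + 2 by ring, ← hC, add_sub_cancel_right]
    rw [h, show 2 * (m + 1) = 2 * m + 2 by ring, cyclotomicOmegaMinus_two_mul_add_two,
      Polynomial.map_mul]
    refine dvd_sub (Dvd.dvd.mul_right ?_ _) ?_
    · rw [← Polynomial.map_mul, ← cyclotomicOmegaMinus_two_mul_add_two,
        ← cyclotomicOmegaMinus_two_mul_add_one, ← X_mul_cyclotomicOmegaPlus_mul_cyclotomicOmegaMinus]
      exact Polynomial.map_dvd _ (dvd_mul_left _ _)
    · rw [mul_comm (((cyclotomic (p ^ (2 * m + 1)) ℤ).comp (X + 1)).map (Int.castRingHom (coeffField g)))]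
      exact mul_dvd_mul ih dvd_rfl

/-- **`ω⁺_{2m+1} ∣ θ_{2m+1}` in `K_g[T]`** (`a_p = 0`), by the same induction from the three-term
relation at the odd levels (`ω⁺_1 = 1`; `ω⁺_{2m+3} = ω⁺_{2m+1} Φ_{p^{2m+2}}(1+T)`)
(Pollack 2003, proof of Prop. 6.18). [cite: Pollack2003, Prop. 6.18 (proof)] -/
theorem cyclotomicOmegaPlus_dvd_mazurTateElementK (hg : IsNewform0 g) (hΩ : IsPlusPeriod g Ω) (hpM : ¬ p ∣ M)
    (hap : cuspCoeff g p = 0) (m : ℕ) :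
    (cyclotomicOmegaPlus p (2 * m + 1)).map (Int.castRingHom (coeffField g)) ∣
      mazurTateElementK g Ω p (2 * m + 1) := by
  induction m with
  | zero =>
    rw [show 2 * 0 + 1 = 2 * 0 + 1 from rfl, cyclotomicOmegaPlus_two_mul_add_one, mul_zero,
      cyclotomicOmegaPlus_zero, Polynomial.map_one]
    exact one_dvd _
  | succ m ih =>
    obtain ⟨C, hC⟩ := cyclotomicOmega_dvd_mazurTateElementK_add hg hΩ hpM hap (2 * m + 1)
    have h : mazurTateElementK g Ω p (2 * (m + 1) + 1) =
        (cyclotomicOmega p (2 * m + 1 + 1)).map (Int.castRingHom (coeffField g)) * C -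
          ((cyclotomic (p ^ (2 * m + 1 + 1)) ℤ).comp (X + 1)).map (Int.castRingHom (coeffField g)) *
            mazurTateElementK g Ω p (2 * m + 1) := by
      rw [show 2 * (m + 1) + 1 = 2 * m + 1 + 2 by ring, ← hC, add_sub_cancel_right]
    have hω : cyclotomicOmegaPlus p (2 * (m + 1) + 1) =
        cyclotomicOmegaPlus p (2 * m + 1) * (cyclotomic (p ^ (2 * m + 1 + 1)) ℤ).comp (X + 1) := by
      rw [show 2 * (m + 1) + 1 = 2 * (m + 1) + 1 from rfl, cyclotomicOmegaPlus_two_mul_add_one,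
        show 2 * (m + 1) = 2 * m + 2 by ring, cyclotomicOmegaPlus_two_mul_add_two,
        cyclotomicOmegaPlus_two_mul_add_one, show 2 * m + 1 + 1 = 2 * m + 2 by ring]
    rw [h, hω, Polynomial.map_mul]
    refine dvd_sub (Dvd.dvd.mul_right ?_ _) ?_
    · rw [← Polynomial.map_mul, ← hω, ← X_mul_cyclotomicOmegaPlus_mul_cyclotomicOmegaMinus,
        show 2 * m + 1 + 1 = 2 * (m + 1) by ring, cyclotomicOmegaPlus_two_mul_add_one]
      exact Polynomial.map_dvd _ (Dvd.dvd.mul_right (dvd_mul_left _ _) _)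
    · rw [mul_comm (((cyclotomic (p ^ (2 * m + 1 + 1)) ℤ).comp (X + 1)).map (Int.castRingHom (coeffField g)))]
      exact mul_dvd_mul ih dvd_rfl

/-- Exact division: if the monic `D` divides `P` then `D · (P /ₘ D) = P`. [folklore] -/
private theorem mul_divByMonic_eq_of_dvd' {R : Type*} [CommRing R] {D P : R[X]} (hD : D.Monic)
    (h : D ∣ P) : D * (P /ₘ D) = P := by
  have h1 := modByMonic_add_div P D
  rwa [(modByMonic_eq_zero_iff_dvd hD).mpr h, zero_add] at h1

/-- **Compatibility of the even quotients**: with `ℓ⁻_m = θ_{2m}/ω⁻_{2m}` (exact quotient in `K_g[T]`),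
`T ω⁺_{2m} ∣ (-1)^{m+2} ℓ⁻_{m+1} − (-1)^{m+1} ℓ⁻_m`. Indeed the three-term relation
`θ_{2m+2} + Φ_{p^{2m+1}}(1+T) θ_{2m} = ω_{2m+1} C` reads
`ω⁻_{2m} Φ_{p^{2m+1}}(1+T) (ℓ⁻_{m+1} + ℓ⁻_m) = T ω⁺_{2m} · ω⁻_{2m} Φ_{p^{2m+1}}(1+T) · C`, and
`ω⁻_{2m} Φ_{p^{2m+1}}(1+T) ≠ 0` cancels (Pollack 2003, proof of Prop. 6.18: the `L⁻`-values at
the `ζ - 1` are compatible along the tower). [cite: Pollack2003, Prop. 6.18 (proof)] -/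
theorem X_mul_cyclotomicOmegaPlus_dvd_sub_minusK (hg : IsNewform0 g) (hΩ : IsPlusPeriod g Ω) (hpM : ¬ p ∣ M)
    (hap : cuspCoeff g p = 0) (m : ℕ) :
    X * (cyclotomicOmegaPlus p (2 * m)).map (Int.castRingHom (coeffField g)) ∣
      (-1) ^ (m + 2) * (mazurTateElementK g Ω p (2 * (m + 1)) /ₘ
          (cyclotomicOmegaMinus p (2 * (m + 1))).map (Int.castRingHom (coeffField g))) -
        (-1) ^ (m + 1) * (mazurTateElementK g Ω p (2 * m) /ₘ
          (cyclotomicOmegaMinus p (2 * m)).map (Int.castRingHom (coeffField g))) := by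
  obtain ⟨C, hC⟩ := cyclotomicOmega_dvd_mazurTateElementK_add hg hΩ hpM hap (2 * m)
  set ξ : (coeffField g)[X] := ((cyclotomic (p ^ (2 * m + 1)) ℤ).comp (X + 1)).map (Int.castRingHom (coeffField g)) with hξ
  set ωm : (coeffField g)[X] := (cyclotomicOmegaMinus p (2 * m)).map (Int.castRingHom (coeffField g)) with hωm
  set ωp : (coeffField g)[X] := (cyclotomicOmegaPlus p (2 * m)).map (Int.castRingHom (coeffField g)) with hωp
  set ℓ₀ := mazurTateElementK g Ω p (2 * m) /ₘ ωm with hℓ₀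
  set ℓ₁ := mazurTateElementK g Ω p (2 * (m + 1)) /ₘ
    (cyclotomicOmegaMinus p (2 * (m + 1))).map (Int.castRingHom (coeffField g)) with hℓ₁
  have hmon0 : ωm.Monic := (monic_cyclotomicOmegaMinus p (2 * m)).map _
  have hmon1 : ((cyclotomicOmegaMinus p (2 * (m + 1))).map (Int.castRingHom (coeffField g))).Monic :=
    (monic_cyclotomicOmegaMinus p _).map _
  have hθ0 : mazurTateElementK g Ω p (2 * m) = ωm * ℓ₀ :=
    (mul_divByMonic_eq_of_dvd' hmon0 (cyclotomicOmegaMinus_dvd_mazurTateElementK hg hΩ hpM hap m)).symm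
  have hθ1 : mazurTateElementK g Ω p (2 * (m + 1)) = ωm * ξ * ℓ₁ := by
    have h := (mul_divByMonic_eq_of_dvd' hmon1
      (cyclotomicOmegaMinus_dvd_mazurTateElementK hg hΩ hpM hap (m + 1))).symm
    rw [h, ← hℓ₁, show 2 * (m + 1) = 2 * m + 2 by ring, cyclotomicOmegaMinus_two_mul_add_two,
      Polynomial.map_mul]
  -- `ω_{2m+1} = T ω⁺_{2m} ω⁻_{2m} Φ_{p^{2m+1}}(1+T)`
  have hΩ : (cyclotomicOmega p (2 * m + 1)).map (Int.castRingHom (coeffField g)) = X * ωp * (ωm * ξ) := by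
    rw [← X_mul_cyclotomicOmegaPlus_mul_cyclotomicOmegaMinus, cyclotomicOmegaPlus_two_mul_add_one,
      cyclotomicOmegaMinus_two_mul_add_one, cyclotomicOmegaMinus_two_mul_add_two,
      Polynomial.map_mul, Polynomial.map_mul, Polynomial.map_mul, Polynomial.map_X]
  have hne : ωm * ξ ≠ 0 :=
    (hmon0.mul ((monic_cyclotomic_comp_X_add_one (p ^ (2 * m + 1))).map _)).ne_zero
  -- cancel `ω⁻_{2m} Φ` in the three-term relation
  have hkey : ℓ₁ + ℓ₀ = X * ωp * C := by
    rw [show 2 * m + 2 = 2 * (m + 1) by ring, hθ1, hθ0, hΩ] at hC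
    have h2 : ωm * ξ * (ℓ₁ + ℓ₀) = ωm * ξ * (X * ωp * C) := by linear_combination hC
    exact mul_left_cancel₀ hne h2
  refine ⟨(-1) ^ (m + 2) * C, ?_⟩
  have h3 : ((-1 : (coeffField g)[X]) ^ (m + 1)) = -((-1) ^ (m + 2)) := by ring
  rw [h3]
  linear_combination ((-1 : (coeffField g)[X]) ^ (m + 2)) * hkey

/-- **Compatibility of the odd quotients**: with `ℓ⁺_m = θ_{2m+1}/ω⁺_{2m+1}`,
`T ω⁻_{2m+1} ∣ (-1)^{m+2} ℓ⁺_{m+1} − (-1)^{m+1} ℓ⁺_m`, from the three-term relation at level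
`2m+1` (`ω_{2m+2} = T ω⁻_{2m+1} · ω⁺_{2m+1} Φ_{p^{2m+2}}(1+T)`)
(Pollack 2003, proof of Prop. 6.18). [cite: Pollack2003, Prop. 6.18 (proof)] -/
theorem X_mul_cyclotomicOmegaMinus_dvd_sub_plusK (hg : IsNewform0 g) (hΩ : IsPlusPeriod g Ω) (hpM : ¬ p ∣ M)
    (hap : cuspCoeff g p = 0) (m : ℕ) :
    X * (cyclotomicOmegaMinus p (2 * m + 1)).map (Int.castRingHom (coeffField g)) ∣
      (-1) ^ (m + 2) * (mazurTateElementK g Ω p (2 * (m + 1) + 1) /ₘ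
          (cyclotomicOmegaPlus p (2 * (m + 1) + 1)).map (Int.castRingHom (coeffField g))) -
        (-1) ^ (m + 1) * (mazurTateElementK g Ω p (2 * m + 1) /ₘ
          (cyclotomicOmegaPlus p (2 * m + 1)).map (Int.castRingHom (coeffField g))) := by
  obtain ⟨C, hC⟩ := cyclotomicOmega_dvd_mazurTateElementK_add hg hΩ hpM hap (2 * m + 1)
  set ξ : (coeffField g)[X] := ((cyclotomic (p ^ (2 * m + 1 + 1)) ℤ).comp (X + 1)).map (Int.castRingHom (coeffField g))
    with hξ
  set ωp : (coeffField g)[X] := (cyclotomicOmegaPlus p (2 * m + 1)).map (Int.castRingHom (coeffField g)) with hωp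
  set ωm : (coeffField g)[X] := (cyclotomicOmegaMinus p (2 * m + 1)).map (Int.castRingHom (coeffField g)) with hωm
  set ℓ₀ := mazurTateElementK g Ω p (2 * m + 1) /ₘ ωp with hℓ₀
  set ℓ₁ := mazurTateElementK g Ω p (2 * (m + 1) + 1) /ₘ
    (cyclotomicOmegaPlus p (2 * (m + 1) + 1)).map (Int.castRingHom (coeffField g)) with hℓ₁
  have hω1 : cyclotomicOmegaPlus p (2 * (m + 1) + 1) =
      cyclotomicOmegaPlus p (2 * m + 1) * (cyclotomic (p ^ (2 * m + 1 + 1)) ℤ).comp (X + 1) := by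
    rw [show 2 * (m + 1) + 1 = 2 * (m + 1) + 1 from rfl, cyclotomicOmegaPlus_two_mul_add_one,
      show 2 * (m + 1) = 2 * m + 2 by ring, cyclotomicOmegaPlus_two_mul_add_two,
      cyclotomicOmegaPlus_two_mul_add_one, show 2 * m + 1 + 1 = 2 * m + 2 by ring]
  have hmon0 : ωp.Monic := (monic_cyclotomicOmegaPlus p (2 * m + 1)).map _
  have hmon1 : ((cyclotomicOmegaPlus p (2 * (m + 1) + 1)).map (Int.castRingHom (coeffField g))).Monic :=
    (monic_cyclotomicOmegaPlus p _).map _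
  have hθ0 : mazurTateElementK g Ω p (2 * m + 1) = ωp * ℓ₀ :=
    (mul_divByMonic_eq_of_dvd' hmon0 (cyclotomicOmegaPlus_dvd_mazurTateElementK hg hΩ hpM hap m)).symm
  have hθ1 : mazurTateElementK g Ω p (2 * (m + 1) + 1) = ωp * ξ * ℓ₁ := by
    have h := (mul_divByMonic_eq_of_dvd' hmon1
      (cyclotomicOmegaPlus_dvd_mazurTateElementK hg hΩ hpM hap (m + 1))).symm
    rw [h, ← hℓ₁, hω1, Polynomial.map_mul]
  -- `ω_{2m+2} = T ω⁻_{2m+1} ω⁺_{2m+1} Φ_{p^{2m+2}}(1+T)`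
  have hΩ : (cyclotomicOmega p (2 * m + 1 + 1)).map (Int.castRingHom (coeffField g)) = X * ωm * (ωp * ξ) := by
    rw [← X_mul_cyclotomicOmegaPlus_mul_cyclotomicOmegaMinus,
      show 2 * m + 1 + 1 = 2 * m + 2 by ring, cyclotomicOmegaPlus_two_mul_add_two,
      ← cyclotomicOmegaMinus_two_mul_add_one, ← cyclotomicOmegaPlus_two_mul_add_one,
      Polynomial.map_mul, Polynomial.map_mul, Polynomial.map_mul, Polynomial.map_X]
    ring
  have hne : ωp * ξ ≠ 0 :=
    (hmon0.mul ((monic_cyclotomic_comp_X_add_one (p ^ (2 * m + 1 + 1))).map _)).ne_zero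
  have hkey : ℓ₁ + ℓ₀ = X * ωm * C := by
    rw [show 2 * m + 1 + 2 = 2 * (m + 1) + 1 by ring, hθ1, hθ0, hΩ] at hC
    have h2 : ωp * ξ * (ℓ₁ + ℓ₀) = ωp * ξ * (X * ωm * C) := by linear_combination hC
    exact mul_left_cancel₀ hne h2
  refine ⟨(-1) ^ (m + 2) * C, ?_⟩
  have h3 : ((-1 : (coeffField g)[X]) ^ (m + 1)) = -((-1) ^ (m + 2)) := by ring
  rw [h3]
  linear_combination ((-1 : (coeffField g)[X]) ^ (m + 2)) * hkey


end Newform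

end Summit.BirchSwinnertonDyer.BirchSwinnertonDyer.Theorems.ResidualThetaLayer

end
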